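import Summits.BirchSwinnertonDyer.BirchSwinnertonDyer.Theorems.EisensteinPrimesMazurMCOnCellBTwistbackValueOfLZZByName
import Summits.BirchSwinnertonDyer.BirchSwinnertonDyer.Theorems.EisensteinPrimesMazurMCOnCellBTwistbackOnePartner
import Summits.BirchSwinnertonDyer.BirchSwinnertonDyer.Theorems.EisensteinPrimesMazurMCOnCellBTwistbackSubrowPartnerAnyLinePAdicGZ
import Summits.BirchSwinnertonDyer.BirchSwinnertonDyer.Theorems.SchneiderFreeAdditiveX3PoitouTateSelmerDualityHolds
import Summits.BirchSwinnertonDyer.BirchSwinnertonDyer.Theorems.SchneiderFreeAdditiveX3PoitouTateShaDualityHolds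
import HarnessLib

/-!
# Crux 3 `MazurMCOnCellB` (stmt-BirchSwinnertonDyer-19033), line `twistback` (v5 sha256 355e1eaf… registered; v6 announced):
# the two POITOU–TATE conjuncts of the registered FACT stub `stub_printedFacts` are THEOREMS OF THE TREE, and the crux
# BY NAME is a conditional kernel theorem on the REMAINING named facts + Keller–Yin Thm. D + the registered open stub 6′

Width seat `bsd-line-x2-p1-w3` g12 (2026-08-28; `--supports` stmt-BirchSwinnertonDyer-19033). THEOREMS ONLY: no `def`, no
named fact introduced, no `sorry`; nothing landed is restated — every step is a by-name application of a tree theorem.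

WHAT. The registered skeleton (`Cruxes/MazurMCOnCellB/Lines/twistback.lean`, v5, LEAD g12; v6, LEAD g13, same ten-conjunct
shape with (2i) Dokchitser–Dokchitser replaced by (2i′) Disegni 2020 Thm. 2.4) carries as conjuncts (2d), (2e) of its
cite-only FACT stub `stub_printedFacts`
* (2d) `∀ K, Literature.NumberTheory.GaloisCohomology.poitouTate_selmerStructure_duality K` (Milne *ADT* I Thm. 4.10 (b) shape), and
* (2e) `∀ K, Literature.NumberTheory.GaloisCohomology.poitouTate_sha_tateDual K` (Milne *ADT* I Thm. 4.10 (a) shape),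
consumed (only) by the in-skeleton derivation `kRankOne_of_thmD` of item -27489 through x2-p1-w4 g3's
`…TwistbackValueOfLZZByName.heegnerIndexIdentityKRankOne_of_thmD_OPEN_of_thm151_thm153 hP hPT hPT2 hH hF hD`.
BOTH are, since 2026-08-28, UNCONDITIONAL THEOREMS of the tree proved in other cells (route-free import closure):
`SchneiderFreeAdditiveX3.PoitouTateReduction.poitouTate_selmerStructure_duality_holds K`
(`Theorems/SchneiderFreeAdditiveX3PoitouTateSelmerDualityHolds.lean`) and
`SchneiderFreeAdditiveX3.PoitouTateReduction.poitouTate_sha_tateDual_holds K`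
(`Theorems/SchneiderFreeAdditiveX3PoitouTateShaDualityHolds.lean`). This file records the consequence for crux 3:

* §1 (no new declaration — the gate's dedup found the stub-shaped `∀ K` wrappers ALREADY landed in other routes' files:
  `SchneiderFreeAdditiveX3.ControlDischarged.pt_selmer_forall` (`Theorems/SchneiderFreeAdditiveX3EndStateControlDischarged.lean`)
  and `PrintCf2.EisensteinTwo.poitouTate_sha_tateDual_forall` (`Theorems/PrintCf2SplitBadTwoRankOneOfFactsPrintsTwoOfThree.lean`);
  they are NOT imported here, to keep route files `SchneiderFreeAdditiveX3Upper` / `UniversalToricDescent` out of this file's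
  import cone — below, (2d)/(2e) are fed as the terms `fun K _ _ ↦ …_holds K` over the two ROUTE-FREE `_holds` theorems);
* §2 `printedFacts_v5_of_eight`, `printedFacts_v6_of_eight` — the registered ten-conjunct STATEMENT of `stub_printedFacts`
  (v5 verbatim, resp. the announced v6 shape) from its EIGHT other conjuncts, so a successor skeleton may cut the stub to
  eight cite-only conjuncts (or keep it and cite this file);
* §3 `heegnerIndexIdentityKRankOne_of_thmD_OPEN_of_hsieh_of_thm151_thm153` — the route's support item -27489
  `EisensteinPrimes.HeegnerIndexIdentityKRankOne` (registered `stub_kRankOne`) from `PublishedInputs` + Hsieh 2014 + LZZ 2018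
  (REFEREED) + Keller–Yin Thm. D (PREPRINT) ONLY — the two Poitou–Tate hypotheses of the w4-g3 door DISCHARGED;
* §4 `mazurMCOnCellB_of_thmD_OPEN_of_exists_upper_partner` — crux 3 BY NAME from `PublishedInputs` + Mazur 1978 Cor. 4.1 +
  Hsieh + LZZ + Keller–Yin Thm. D + (∃-PARTNER) at every X2b pair (v4's `stub_upperPartner` statement verbatim);
* §5 `mazurMCOnCellB_of_namedFacts_of_upperPartnerOffSubrow` — crux 3 BY NAME from EXACTLY the v6 cone with the Poitou–Tate
  facts gone: `PublishedInputs` (item -19037) + SEVEN named PUBLISHED facts {Disegni 2020 Thm. 4(1), Mazur Cor. 4.1, Hsieh 2014,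
  LZZ 2018 Thms. 1.5.1/1.5.3, Greenberg–Vatsal Thm. (3.11), Disegni 2020 Thm. 2.4, Nakagawa–Horie–Taya} + Keller–Yin Thm. D
  (PRE) + the registered open stub 6′ `stub_upperPartnerOffSubrow` (statement verbatim) — the v6 terms `upperPartner_onSubrow`
  / `upperPartner_all` / `MazurMCOnCellB_of` re-run on the Theorems side over hypotheses instead of `sorry`-stubs. The
  Bump–Friedberg–Hoffstein conjunct (2b) is not in this cone (it serves only the road stubs 4/5 ⟹ 6).

HONEST FRAMING: conditional theorems; the named facts enter exactly as labelled (PUBLISHED ×7 + the route's FACT item;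
Keller–Yin Thm. D is an UNREFEREED PREPRINT, arXiv:2402.12781v2 Thm. 5.1.3, flag `KYD-gap`); stub 6′ is OPEN as registered;
no registered stub is closed by this file; no summit statement, no Mazur main conjecture and no case of BSD is proved for any
curve; 0 cells / labels / tiers move. What moves: the crux's cite-only PUBLISHED inputs are 7 (+ item -19037), not 10 — two
are kernel theorems, one (BFH) is outside the cone.

References: [MilneADT2006] Ch. I Thm. 4.10 (a), (b); [KellerYin2024] Thm. D (PRE); [LiuZhangZhang2018] Thms. 1.5.1/1.5.3;
[Hsieh2014] Thm. A; [Mazur1978] Cor. 4.1; [Disegni2020] Thm. 2.4, Thm. 4; [GreenbergVatsal2000] Thm. (3.11);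
[NakagawaHorie1988] Thm. 1; [Castella2018] §5.
-/

set_option autoImplicit false

-- `Summit.BirchSwinnertonDyer.BirchSwinnertonDyer.…`: the summit and its single sub-problem share a name.
set_option linter.dupNamespace false

noncomputable section

open scoped Classical MatrixGroups ModularForm

open CongruenceSubgroup WeierstrassCurve NumberField IsDedekindDomain Field
  Literature.NumberTheory.GaloisRepresentations
  Literature.NumberTheory.GaloisCohomology
  Literature.NumberTheory.EllipticCurves
  Literature.NumberTheory.EllipticCurves.ModularForms
  Literature.NumberTheory.QuadraticFields
  Literature.NumberTheory.EllipticCurves.Rank1Residual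
  Literature.NumberTheory.EllipticCurves.Rank1Residual.Typed
  Literature.NumberTheory.EllipticCurves.Wuthrich2014
  Literature.NumberTheory.EllipticCurves.SteinWuthrich2013
  Literature.NumberTheory.EllipticCurves.GreenbergVatsal2000
  Literature.NumberTheory.EllipticCurves.Disegni2020
  Summit.BirchSwinnertonDyer.Rank1Residual
  Summit.BirchSwinnertonDyer.BirchSwinnertonDyer.Theses
  Summit.BirchSwinnertonDyer.BirchSwinnertonDyer.Theorems

namespace Summit.BirchSwinnertonDyer.BirchSwinnertonDyer.Theorems.EisensteinPrimesMazurMCOnCellBOfNamedFacts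

/-! ## §1. The two Poitou–Tate conjuncts of `stub_printedFacts` are theorems of the tree

No declaration here (dedup): conjunct (2d) `∀ K, poitouTate_selmerStructure_duality K` is the term
`fun K _ _ ↦ SchneiderFreeAdditiveX3.PoitouTateReduction.poitouTate_selmerStructure_duality_holds K` (Milne *ADT* I Thm. 4.10 (b)
shape; cell bsd-schneider, route-free; the stub-shaped wrapper is landed as `SchneiderFreeAdditiveX3.ControlDischarged.pt_selmer_forall`),
conjunct (2e) `∀ K, poitouTate_sha_tateDual K` is the term
`fun K _ _ ↦ SchneiderFreeAdditiveX3.PoitouTateReduction.poitouTate_sha_tateDual_holds K` (Milne *ADT* I Thm. 4.10 (a) shape;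
route-free; wrapper landed as `PrintCf2.EisensteinTwo.poitouTate_sha_tateDual_forall`). Both UNCONDITIONAL. -/

/-! ## §2. The registered ten-conjunct statement from its eight other conjuncts -/

/-- **`stub_printedFacts` (v5, REGISTERED sha256 355e1eaf…) — its STATEMENT VERBATIM from the EIGHT conjuncts other than
(2d)/(2e)**: Disegni 2020 Thm. 4(1), Bump–Friedberg–Hoffstein 1990, Mazur 1978 Cor. 4.1, Hsieh 2014 Thm. A, LZZ 2018
Thms. 1.5.1/1.5.3, Greenberg–Vatsal Thm. (3.11), Dokchitser–Dokchitser Thm. 1.4, Nakagawa–Horie–Taya (all PUBLISHED, taken as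
hypotheses BY NAME; nothing asserted). Bookkeeping for a successor skeleton. [cite: MilneADT2006, Ch. I, Thm. 4.10 (a), (b)]
[cite: Disegni2020, Thm. 4 (§3.2)] [cite: DokchitserDokchitserAnnals2010, Thm. 1.4] -/
theorem printedFacts_v5_of_eight (hDis : padicBSD_rankOne_nonsplitMult)
    (hBFH : bumpFriedbergHoffstein_exists_heegnerField_split_twist_simpleZero)
    (hMaz : mazur_not_dvd_maninConstant_of_odd) (hH : hsieh2014_exists_anticyclotomicPAdicLFunction)
    (hF : LiuZhangZhang2018.thm151_thm153_modularCurve_heegnerVector)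
    (h311 : thm311_hasUnitContent_iff_and_order_eq_of_lineRamifiedEven)
    (hDD : ∀ (V : WeierstrassCurve ℚ) [V.IsElliptic] (ℓ : ℕ) [Fact ℓ.Prime], selmerCorank_mod_two_eq V ℓ)
    (hNHT : Literature.NumberTheory.QuadraticFields.nakagawaHorie_taya_exists_imaginary_h3_eq_one) :
    padicBSD_rankOne_nonsplitMult ∧ bumpFriedbergHoffstein_exists_heegnerField_split_twist_simpleZero ∧
      mazur_not_dvd_maninConstant_of_odd ∧
      (∀ (K : Type) [Field K] [NumberField K], Literature.NumberTheory.GaloisCohomology.poitouTate_selmerStructure_duality K) ∧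
      (∀ (K : Type) [Field K] [NumberField K], Literature.NumberTheory.GaloisCohomology.poitouTate_sha_tateDual K) ∧
      hsieh2014_exists_anticyclotomicPAdicLFunction ∧ LiuZhangZhang2018.thm151_thm153_modularCurve_heegnerVector ∧
      thm311_hasUnitContent_iff_and_order_eq_of_lineRamifiedEven ∧
      (∀ (V : WeierstrassCurve ℚ) [V.IsElliptic] (ℓ : ℕ) [Fact ℓ.Prime], selmerCorank_mod_two_eq V ℓ) ∧
      Literature.NumberTheory.QuadraticFields.nakagawaHorie_taya_exists_imaginary_h3_eq_one :=
  ⟨hDis, hBFH, hMaz, fun K _ _ ↦ SchneiderFreeAdditiveX3.PoitouTateReduction.poitouTate_selmerStructure_duality_holds K,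
    fun K _ _ ↦ SchneiderFreeAdditiveX3.PoitouTateReduction.poitouTate_sha_tateDual_holds K, hH, hF, h311, hDD, hNHT⟩

/-- **`stub_printedFacts` (v6 shape, LEAD g13 announce 2026-08-28T19:35Z, sha256 56f80a58…: conjunct (2i′) Disegni 2020
Thm. 2.4 in place of Dokchitser–Dokchitser) — its STATEMENT from the EIGHT conjuncts other than (2d)/(2e)** (all PUBLISHED,
hypotheses BY NAME). Bookkeeping for a successor skeleton. [cite: MilneADT2006, Ch. I, Thm. 4.10 (a), (b)]
[cite: Disegni2020, §2.2 Thm. 2.4 and §3.2 Thm. 4] -/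
theorem printedFacts_v6_of_eight (hDis : padicBSD_rankOne_nonsplitMult)
    (hBFH : bumpFriedbergHoffstein_exists_heegnerField_split_twist_simpleZero)
    (hMaz : mazur_not_dvd_maninConstant_of_odd) (hH : hsieh2014_exists_anticyclotomicPAdicLFunction)
    (hF : LiuZhangZhang2018.thm151_thm153_modularCurve_heegnerVector)
    (h311 : thm311_hasUnitContent_iff_and_order_eq_of_lineRamifiedEven)
    (hDGZ : Disegni2020.padicGrossZagier_nonsplitMult)
    (hNHT : Literature.NumberTheory.QuadraticFields.nakagawaHorie_taya_exists_imaginary_h3_eq_one) :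
    padicBSD_rankOne_nonsplitMult ∧ bumpFriedbergHoffstein_exists_heegnerField_split_twist_simpleZero ∧
      mazur_not_dvd_maninConstant_of_odd ∧
      (∀ (K : Type) [Field K] [NumberField K], Literature.NumberTheory.GaloisCohomology.poitouTate_selmerStructure_duality K) ∧
      (∀ (K : Type) [Field K] [NumberField K], Literature.NumberTheory.GaloisCohomology.poitouTate_sha_tateDual K) ∧
      hsieh2014_exists_anticyclotomicPAdicLFunction ∧ LiuZhangZhang2018.thm151_thm153_modularCurve_heegnerVector ∧
      thm311_hasUnitContent_iff_and_order_eq_of_lineRamifiedEven ∧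
      Disegni2020.padicGrossZagier_nonsplitMult ∧
      Literature.NumberTheory.QuadraticFields.nakagawaHorie_taya_exists_imaginary_h3_eq_one :=
  ⟨hDis, hBFH, hMaz, fun K _ _ ↦ SchneiderFreeAdditiveX3.PoitouTateReduction.poitouTate_selmerStructure_duality_holds K,
    fun K _ _ ↦ SchneiderFreeAdditiveX3.PoitouTateReduction.poitouTate_sha_tateDual_holds K, hH, hF, h311, hDGZ, hNHT⟩

/-! ## §3. Item -27489 (registered `stub_kRankOne`) from Keller–Yin Thm. D + PUBLISHED facts — Poitou–Tate discharged -/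

/-- **The route's support item stmt-BirchSwinnertonDyer-27489 `EisensteinPrimes.HeegnerIndexIdentityKRankOne` FROM
KELLER–YIN THM. D + `PublishedInputs` + Hsieh 2014 + LZZ 2018 ONLY**: x2-p1-w4 g3's
`…TwistbackValueOfLZZByName.heegnerIndexIdentityKRankOne_of_thmD_OPEN_of_thm151_thm153` with its two Poitou–Tate hypotheses
`hPT`, `hPT2` fed by the route-free tree theorems `…PoitouTateReduction.poitouTate_selmerStructure_duality_holds` /
`…poitouTate_sha_tateDual_holds` (§1). So item -27489 = Thm. D (UNREFEREED PREPRINT, gapped at L1754) + PUBLISHED; CONDITIONAL, credits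
nothing; BSD / MC proved for no curve. [claim: KellerYin2024, status: under-review]
[cite: KellerYin2024, Thm. D = Thm. 5.1.3 (arXiv:2402.12781v2 L306–L309)] [cite: LiuZhangZhang2018, Thm. 1.5.1 and Thm. 1.5.3]
[cite: Hsieh2014, Thm. A (p. 712)] [cite: Castella2018, §5 (5.1)–(5.3) (arXiv:1704.06608 p. 12)] -/
theorem heegnerIndexIdentityKRankOne_of_thmD_OPEN_of_hsieh_of_thm151_thm153 (hP : EisensteinPrimes.PublishedInputs)
    (hH : hsieh2014_exists_anticyclotomicPAdicLFunction)
    (hF : LiuZhangZhang2018.thm151_thm153_modularCurve_heegnerVector)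
    (hD : KellerYin2024.thmD_imcMult_exists_isBDPLFunction_isTorsion_charIdeal_eq_OPEN) :
    EisensteinPrimes.HeegnerIndexIdentityKRankOne :=
  EisensteinPrimesMazurMCOnCellBTwistbackValueOfLZZByName.heegnerIndexIdentityKRankOne_of_thmD_OPEN_of_thm151_thm153 hP
    (fun K _ _ ↦ SchneiderFreeAdditiveX3.PoitouTateReduction.poitouTate_selmerStructure_duality_holds K)
    (fun K _ _ ↦ SchneiderFreeAdditiveX3.PoitouTateReduction.poitouTate_sha_tateDual_holds K) hH hF hD

/-! ## §4. Crux 3 BY NAME from the v4 cone, Poitou–Tate discharged -/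

/-- **Crux 3 `MazurMCOnCellB` BY NAME from `PublishedInputs` + Mazur 1978 Cor. 4.1 + Hsieh 2014 + LZZ 2018 (PUBLISHED /
refereed) + Keller–Yin Thm. D (PREPRINT) + (∃-PARTNER) at every X2b pair** (v4's registered `stub_upperPartner` statement
verbatim as the hypothesis `hPartner`): LEAD g9's `…TwistbackOnePartner.mazurMCOnCellB_of_kRankOne_of_exists_upper_partner`
with item -27489 supplied by §3. Versus the docstring of that door («Poitou–Tate ×2 ∧ …»): the two Poitou–Tate facts are no
longer hypotheses. CONDITIONAL; (∃-PARTNER) is OPEN class-wide; BSD / MC proved for no curve.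
[claim: KellerYin2024, status: under-review] [cite: KellerYin2024, Thm. D = Thm. 5.1.3] [cite: Mazur1978, Cor. 4.1]
[cite: Darmon2004, Thm. 3.6] [cite: JetchevSkinnerWan2017, §7.4.1] -/
theorem mazurMCOnCellB_of_thmD_OPEN_of_exists_upper_partner (hP : EisensteinPrimes.PublishedInputs)
    (hMaz : mazur_not_dvd_maninConstant_of_odd) (hH : hsieh2014_exists_anticyclotomicPAdicLFunction)
    (hF : LiuZhangZhang2018.thm151_thm153_modularCurve_heegnerVector)
    (hD : KellerYin2024.thmD_imcMult_exists_isBDPLFunction_isTorsion_charIdeal_eq_OPEN)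
    (hPartner : ∀ (W : WeierstrassCurve ℚ) [W.IsElliptic] [W.IsGloballyMinimal] (p : ℕ) [Fact p.Prime],
      X2.CellB W p →
      ∃ (K : Type) (_ : Field K) (_ : NumberField K), IsImaginaryQuadratic K ∧
        SatisfiesHeegnerHypothesis (W.conductorNorm ℤ) K ∧ SatisfiesHeegnerHypothesis p K ∧
        Odd (NumberField.discr K) ∧ NumberField.discr K < -4 ∧
        (W.quadraticTwist (NumberField.discr K : ℚ)).analyticRank = 1 ∧
        ∀ (Wd : WeierstrassCurve ℚ) [Wd.IsElliptic] [Wd.IsGloballyMinimal],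
          (∃ C : VariableChange ℚ, C • Wd = W.quadraticTwist (NumberField.discr K : ℚ)) →
          MissingUpperBoundAt Wd p) :
    EisensteinPrimes.MazurMCOnCellB :=
  EisensteinPrimesMazurMCOnCellBTwistbackOnePartner.mazurMCOnCellB_of_kRankOne_of_exists_upper_partner hP hMaz
    (heegnerIndexIdentityKRankOne_of_thmD_OPEN_of_hsieh_of_thm151_thm153 hP hH hF hD) hPartner

/-! ## §5. Crux 3 BY NAME from exactly the v6 cone, Poitou–Tate discharged: `PublishedInputs` + 7 PUBLISHED named facts +
Keller–Yin Thm. D + the registered open stub 6′ -/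

/-- **(∃-PARTNER) AT EVERY X2b PAIR from the registered open stub 6′ (statement verbatim as hypothesis `hOff`) and the
PUBLISHED sub-row facts** — the v6 skeleton's `upperPartner_all` run on the Theorems side: excluded middle on «`p = 3` ∧ `3`
non-split ∧ ∃ balance-1 rational 3-line datum»; ON that sub-row x2-p1-w3 g11's
`…TwistbackSubrowPartnerAnyLinePAdicGZ.upperPartner_at_three_of_balanceOne_of_padicGZ` (PUBLISHED inputs only:
`PublishedInputs`, Disegni Thm. 4(1), GV Thm. (3.11), Disegni Thm. 2.4, Nakagawa–Horie–Taya), OFF it the hypothesis.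
Conditional; nothing about any curve is proved unconditionally. [cite: GreenbergVatsal2000, §3 Thm. (3.11)]
[cite: Disegni2020, §2.2 Thm. 2.4 and §3.2 Thm. 4] [cite: NakagawaHorie1988, Thm. 1] [cite: Wuthrich2014, Thm. 16 (p. 397)] -/
theorem upperPartner_all_of_namedFacts_of_upperPartnerOffSubrow (hP : EisensteinPrimes.PublishedInputs)
    (hDis : padicBSD_rankOne_nonsplitMult) (h311 : thm311_hasUnitContent_iff_and_order_eq_of_lineRamifiedEven)
    (hDGZ : Disegni2020.padicGrossZagier_nonsplitMult)
    (hNHT : Literature.NumberTheory.QuadraticFields.nakagawaHorie_taya_exists_imaginary_h3_eq_one)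
    (hOff : ∀ (W : WeierstrassCurve ℚ) [W.IsElliptic] [W.IsGloballyMinimal] (p : ℕ) [Fact p.Prime],
      X2.CellB W p →
      ¬ (p = 3 ∧ ¬ W.HasSplitMultiplicativeReductionAtPrime 3 ∧
          ∃ (Φ₀ : AddSubgroup (geomTorsion W (3 : ℤ))) (m : ℕ) (_ : NeZero m) (φ : DirichletCharacter (ZMod 3) m)
            (d : ℕ) (_ : NeZero d) (ψ : DirichletCharacter (ZMod 3) d) (S₀ : Finset (HeightOneSpectrum (𝓞 ℚ))),
            IsRationalLine W 3 Φ₀ ∧ φ.IsPrimitive ∧ ψ.IsPrimitive ∧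
            (∀ (σ : absoluteGaloisGroup ℚ), ∀ P ∈ Φ₀,
              σ • P = (φ ((modNCyclotomicCharacter ℚ m σ : (ZMod m)ˣ) : ZMod m)).val • P) ∧
            (∀ (σ : absoluteGaloisGroup ℚ) (P : geomTorsion W (3 : ℤ)),
              σ • P - (ψ ((modNCyclotomicCharacter ℚ d σ : (ZMod d)ˣ) : ZMod d)).val • P ∈ Φ₀) ∧
            (∀ v ∈ S₀, ((3 : ℕ) : 𝓞 ℚ) ∉ v.asIdeal) ∧
            (∀ v : HeightOneSpectrum (𝓞 ℚ), v ∉ S₀ → ((3 : ℕ) : 𝓞 ℚ) ∉ v.asIdeal → W.HasGoodReductionAt v) ∧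
            1 + ∑ v ∈ S₀, delta W 3 v =
              ∑ v ∈ S₀, ((if φ (Rat.HeightOneSpectrum.natGenerator v : ZMod m) =
                    (Rat.HeightOneSpectrum.natGenerator v : ZMod 3)
                  then sFactor 3 (Rat.HeightOneSpectrum.natGenerator v) else 0) +
                (if ψ (Rat.HeightOneSpectrum.natGenerator v : ZMod d) =
                    (Rat.HeightOneSpectrum.natGenerator v : ZMod 3)
                  then sFactor 3 (Rat.HeightOneSpectrum.natGenerator v) else 0))) →
      ∃ (K : Type) (_ : Field K) (_ : NumberField K), IsImaginaryQuadratic K ∧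
        SatisfiesHeegnerHypothesis (W.conductorNorm ℤ) K ∧ SatisfiesHeegnerHypothesis p K ∧
        Odd (NumberField.discr K) ∧ NumberField.discr K < -4 ∧
        (W.quadraticTwist (NumberField.discr K : ℚ)).analyticRank = 1 ∧
        ∀ (Wd : WeierstrassCurve ℚ) [Wd.IsElliptic] [Wd.IsGloballyMinimal],
          (∃ C : VariableChange ℚ, C • Wd = W.quadraticTwist (NumberField.discr K : ℚ)) →
          MissingUpperBoundAt Wd p) :
    ∀ (W : WeierstrassCurve ℚ) [W.IsElliptic] [W.IsGloballyMinimal] (p : ℕ) [Fact p.Prime],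
      X2.CellB W p →
      ∃ (K : Type) (_ : Field K) (_ : NumberField K), IsImaginaryQuadratic K ∧
        SatisfiesHeegnerHypothesis (W.conductorNorm ℤ) K ∧ SatisfiesHeegnerHypothesis p K ∧
        Odd (NumberField.discr K) ∧ NumberField.discr K < -4 ∧
        (W.quadraticTwist (NumberField.discr K : ℚ)).analyticRank = 1 ∧
        ∀ (Wd : WeierstrassCurve ℚ) [Wd.IsElliptic] [Wd.IsGloballyMinimal],
          (∃ C : VariableChange ℚ, C • Wd = W.quadraticTwist (NumberField.discr K : ℚ)) →
          MissingUpperBoundAt Wd p := by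
  intro W _ _ p _ hc
  by_cases hsub : p = 3 ∧ ¬ W.HasSplitMultiplicativeReductionAtPrime 3 ∧
      ∃ (Φ₀ : AddSubgroup (geomTorsion W (3 : ℤ))) (m : ℕ) (_ : NeZero m) (φ : DirichletCharacter (ZMod 3) m)
        (d : ℕ) (_ : NeZero d) (ψ : DirichletCharacter (ZMod 3) d) (S₀ : Finset (HeightOneSpectrum (𝓞 ℚ))),
        IsRationalLine W 3 Φ₀ ∧ φ.IsPrimitive ∧ ψ.IsPrimitive ∧
        (∀ (σ : absoluteGaloisGroup ℚ), ∀ P ∈ Φ₀,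
          σ • P = (φ ((modNCyclotomicCharacter ℚ m σ : (ZMod m)ˣ) : ZMod m)).val • P) ∧
        (∀ (σ : absoluteGaloisGroup ℚ) (P : geomTorsion W (3 : ℤ)),
          σ • P - (ψ ((modNCyclotomicCharacter ℚ d σ : (ZMod d)ˣ) : ZMod d)).val • P ∈ Φ₀) ∧
        (∀ v ∈ S₀, ((3 : ℕ) : 𝓞 ℚ) ∉ v.asIdeal) ∧
        (∀ v : HeightOneSpectrum (𝓞 ℚ), v ∉ S₀ → ((3 : ℕ) : 𝓞 ℚ) ∉ v.asIdeal → W.HasGoodReductionAt v) ∧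
        1 + ∑ v ∈ S₀, delta W 3 v =
          ∑ v ∈ S₀, ((if φ (Rat.HeightOneSpectrum.natGenerator v : ZMod m) =
                (Rat.HeightOneSpectrum.natGenerator v : ZMod 3)
              then sFactor 3 (Rat.HeightOneSpectrum.natGenerator v) else 0) +
            (if ψ (Rat.HeightOneSpectrum.natGenerator v : ZMod d) =
                (Rat.HeightOneSpectrum.natGenerator v : ZMod 3)
              then sFactor 3 (Rat.HeightOneSpectrum.natGenerator v) else 0))
  · obtain ⟨hp3, hns, hbal⟩ := hsub
    subst hp3
    exact EisensteinPrimesMazurMCOnCellBTwistbackSubrowPartnerAnyLinePAdicGZ.upperPartner_at_three_of_balanceOne_of_padicGZ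
      hP hDis h311 hDGZ hNHT W hc hns hbal
  · exact hOff W p hc hsub

/-- **CRUX 3 `MazurMCOnCellB` BY NAME FROM EXACTLY THE v6 CONE WITH POITOU–TATE DISCHARGED**: the route's FACT item
`PublishedInputs` (stmt-…-19037) + SEVEN PUBLISHED named facts — Disegni 2020 Thm. 4(1) (`hDis`), Mazur 1978 Cor. 4.1
(`hMaz`), Hsieh 2014 Thm. A (`hH`), Liu–Zhang–Zhang 2018 Thms. 1.5.1/1.5.3 (`hF`), Greenberg–Vatsal 2000 Thm. (3.11) (`h311`),
Disegni 2020 Thm. 2.4 (`hDGZ`), Nakagawa–Horie 1988 + Taya 2000 (`hNHT`) — + Keller–Yin Thm. D (`hD`, UNREFEREED PREPRINT) +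
the REGISTERED OPEN STUB 6′ `stub_upperPartnerOffSubrow` of skeleton v5/v6 (statement verbatim, `hOff`) ⟹ the crux decl.
= the v6 skeleton's `MazurMCOnCellB_of` with the `sorry`-stubs replaced by these hypotheses and conjuncts (2b), (2d), (2e)
of `stub_printedFacts` absent ((2d)/(2e) are tree theorems, §1; (2b) BFH is not consumed). CONDITIONAL on the named facts
exactly as labelled and on the OPEN stub 6′; no summit statement, no Mazur MC, no BSD is proved for any curve by this.
[claim: KellerYin2024, status: under-review] [cite: KellerYin2024, Thm. D = Thm. 5.1.3 (arXiv:2402.12781v2 L306–L309)]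
[cite: Disegni2020, §2.2 Thm. 2.4 and §3.2 Thm. 4] [cite: GreenbergVatsal2000, §3 Thm. (3.11)] [cite: Mazur1978, Cor. 4.1]
[cite: LiuZhangZhang2018, Thm. 1.5.1 and Thm. 1.5.3] [cite: Hsieh2014, Thm. A (p. 712)] [cite: NakagawaHorie1988, Thm. 1] -/
theorem mazurMCOnCellB_of_namedFacts_of_upperPartnerOffSubrow (hP : EisensteinPrimes.PublishedInputs)
    (hDis : padicBSD_rankOne_nonsplitMult) (hMaz : mazur_not_dvd_maninConstant_of_odd)
    (hH : hsieh2014_exists_anticyclotomicPAdicLFunction) (hF : LiuZhangZhang2018.thm151_thm153_modularCurve_heegnerVector)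
    (h311 : thm311_hasUnitContent_iff_and_order_eq_of_lineRamifiedEven) (hDGZ : Disegni2020.padicGrossZagier_nonsplitMult)
    (hNHT : Literature.NumberTheory.QuadraticFields.nakagawaHorie_taya_exists_imaginary_h3_eq_one)
    (hD : KellerYin2024.thmD_imcMult_exists_isBDPLFunction_isTorsion_charIdeal_eq_OPEN)
    (hOff : ∀ (W : WeierstrassCurve ℚ) [W.IsElliptic] [W.IsGloballyMinimal] (p : ℕ) [Fact p.Prime],
      X2.CellB W p →
      ¬ (p = 3 ∧ ¬ W.HasSplitMultiplicativeReductionAtPrime 3 ∧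
          ∃ (Φ₀ : AddSubgroup (geomTorsion W (3 : ℤ))) (m : ℕ) (_ : NeZero m) (φ : DirichletCharacter (ZMod 3) m)
            (d : ℕ) (_ : NeZero d) (ψ : DirichletCharacter (ZMod 3) d) (S₀ : Finset (HeightOneSpectrum (𝓞 ℚ))),
            IsRationalLine W 3 Φ₀ ∧ φ.IsPrimitive ∧ ψ.IsPrimitive ∧
            (∀ (σ : absoluteGaloisGroup ℚ), ∀ P ∈ Φ₀,
              σ • P = (φ ((modNCyclotomicCharacter ℚ m σ : (ZMod m)ˣ) : ZMod m)).val • P) ∧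
            (∀ (σ : absoluteGaloisGroup ℚ) (P : geomTorsion W (3 : ℤ)),
              σ • P - (ψ ((modNCyclotomicCharacter ℚ d σ : (ZMod d)ˣ) : ZMod d)).val • P ∈ Φ₀) ∧
            (∀ v ∈ S₀, ((3 : ℕ) : 𝓞 ℚ) ∉ v.asIdeal) ∧
            (∀ v : HeightOneSpectrum (𝓞 ℚ), v ∉ S₀ → ((3 : ℕ) : 𝓞 ℚ) ∉ v.asIdeal → W.HasGoodReductionAt v) ∧
            1 + ∑ v ∈ S₀, delta W 3 v =
              ∑ v ∈ S₀, ((if φ (Rat.HeightOneSpectrum.natGenerator v : ZMod m) =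
                    (Rat.HeightOneSpectrum.natGenerator v : ZMod 3)
                  then sFactor 3 (Rat.HeightOneSpectrum.natGenerator v) else 0) +
                (if ψ (Rat.HeightOneSpectrum.natGenerator v : ZMod d) =
                    (Rat.HeightOneSpectrum.natGenerator v : ZMod 3)
                  then sFactor 3 (Rat.HeightOneSpectrum.natGenerator v) else 0))) →
      ∃ (K : Type) (_ : Field K) (_ : NumberField K), IsImaginaryQuadratic K ∧
        SatisfiesHeegnerHypothesis (W.conductorNorm ℤ) K ∧ SatisfiesHeegnerHypothesis p K ∧
        Odd (NumberField.discr K) ∧ NumberField.discr K < -4 ∧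
        (W.quadraticTwist (NumberField.discr K : ℚ)).analyticRank = 1 ∧
        ∀ (Wd : WeierstrassCurve ℚ) [Wd.IsElliptic] [Wd.IsGloballyMinimal],
          (∃ C : VariableChange ℚ, C • Wd = W.quadraticTwist (NumberField.discr K : ℚ)) →
          MissingUpperBoundAt Wd p) :
    Summit.BirchSwinnertonDyer.BirchSwinnertonDyer.Theses.EisensteinPrimes.MazurMCOnCellB :=
  mazurMCOnCellB_of_thmD_OPEN_of_exists_upper_partner hP hMaz hH hF hD
    (upperPartner_all_of_namedFacts_of_upperPartnerOffSubrow hP hDis h311 hDGZ hNHT hOff)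

end Summit.BirchSwinnertonDyer.BirchSwinnertonDyer.Theorems.EisensteinPrimesMazurMCOnCellBOfNamedFacts

end
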